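import Literature.Geometry.Riemannian.MetricFlowFDistancePseudoMetric
import Literature.Geometry.Riemannian.RicciFlowMetricFlowPairConcentration
import HarnessLib

/-!
# Ricci flows as points of the pseudometric space `(HConc I, d_𝔽)` (Bamler 2023, §7.1, Lemma 7.3
# with §5.2, Thm. 5.13)

R. Bamler, *Compactness theory of the space of super Ricci flows*, Invent. Math. 233 (2023): the
metric flow pair of a compact Ricci flow with a conjugate heat kernel (`ricciFlowMetricFlowPair`,
§7.1 Lemma 7.3 / arXiv v1 Lemma 154) is `H_m`-concentrated with measurable exceptional set
`[a, T] ∖ (a, T) = {a, T}`, hence an element of the type `MetricFlowPair.HConc [a, T]` on which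
`d_𝔽` is an extended pseudometric (`MetricFlowPair.HConc.pseudoEMetricSpace`, §5.2 Thm. 5.13):
`ricciFlowHConc`. Consequently the `𝔽`-distance between (the pairs of) compact Ricci flows over a
common `[a, T]` satisfies the triangle inequality and vanishes on the diagonal
(`fDist_ricciFlowMetricFlowPair_triangle`, `fDist_ricciFlowMetricFlowPair_self`). Everything is
proved; no named facts.

## References

* R. H. Bamler, *Compactness theory of the space of super Ricci flows*, Invent. Math. 233 (2023),
  1121–1277, §7.1 Lemma 7.3; §5.2 Theorem 5.13. [Bamler2023]
-/

noncomputable section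

open Set MeasureTheory Filter TopologicalSpace Function
open scoped Manifold ContDiff Topology ENNReal NNReal

namespace Literature.Geometry.Riemannian

open Lorentzian Lorentzian.PseudoRiemannianMetric

universe u

variable {m : ℕ} {H : Type*} [TopologicalSpace H]
  {I : ModelWithCorners ℝ (EuclideanSpace ℝ (Fin m)) H} [I.Boundaryless]
  {M : Type u} [TopologicalSpace M] [ChartedSpace H M] [IsManifold I ∞ M]
  [T2Space M] [CompactSpace M] [SecondCountableTopology M] [MeasurableSpace M] [BorelSpace M]
  [ConnectedSpace M]
  {h : ℝ → PseudoRiemannianMetric I ∞ (EuclideanSpace ℝ (Fin m)) (TangentSpace I : M → Type _)}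
  {cov : ℝ → CovariantDerivative I (EuclideanSpace ℝ (Fin m)) (TangentSpace I : M → Type _)}
  {a T : ℝ}

/-- **The pair of a compact Ricci flow as a point of `HConc [a, T]`** (H_m-concentrated,
`ricciFlowMetricFlowPair_isHConcentrated`; measurable exceptional set `{a, T}`,
`measurableSet_Icc_diff_ricciFlowMetricFlowPair_I'`). [cite: Bamler2023, §7.1, Lemma 7.3] -/
def ricciFlowHConc (hm : 0 < m) (hflow : IsRicciFlow h cov (Icc a T))
    (hh : IsContMDiffFamilyOn ∞ h univ) (hR : ∀ r, (h r).IsRiemannian) (haT : a < T) (x₀ : M) :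
    MetricFlowPair.HConc.{u} (Icc a T) :=
  ⟨ricciFlowMetricFlowPair hh hR hflow haT x₀,
    ⟨_, ricciFlowMetricFlowPair_isHConcentrated hm hflow hh hR haT x₀⟩,
    measurableSet_Icc_diff_ricciFlowMetricFlowPair_I' hh hR hflow haT x₀⟩

/-- The underlying pair of `ricciFlowHConc` is `ricciFlowMetricFlowPair`. [cite: Bamler2023, §7.1, Lemma 7.3] -/
@[simp] theorem ricciFlowHConc_toPair (hm : 0 < m) (hflow : IsRicciFlow h cov (Icc a T))
    (hh : IsContMDiffFamilyOn ∞ h univ) (hR : ∀ r, (h r).IsRiemannian) (haT : a < T) (x₀ : M) :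
    (ricciFlowHConc hm hflow hh hR haT x₀).toPair = ricciFlowMetricFlowPair hh hR hflow haT x₀ :=
  rfl

/-- **`d_𝔽` vanishes on the diagonal for the pairs of compact Ricci flows.**
[cite: Bamler2023, §5.2, Theorem (metric space)] -/
theorem fDist_ricciFlowMetricFlowPair_self (hflow : IsRicciFlow h cov (Icc a T))
    (hh : IsContMDiffFamilyOn ∞ h univ) (hR : ∀ r, (h r).IsRiemannian) (haT : a < T) (x₀ : M) :
    MetricFlowPair.fDist ∅ (ricciFlowMetricFlowPair hh hR hflow haT x₀)
      (ricciFlowMetricFlowPair hh hR hflow haT x₀) = 0 :=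
  MetricFlowPair.fDist_self _ (empty_subset _)
    (measurableSet_Icc_diff_ricciFlowMetricFlowPair_I' hh hR hflow haT x₀)

/-- **Triangle inequality of `d_𝔽` for the pairs of three compact Ricci flows over a common
`[a, T]`** (possibly on different manifolds in the same universe).
[cite: Bamler2023, §5.2, Theorem (metric space)] -/
theorem fDist_ricciFlowMetricFlowPair_triangle (hm : 0 < m)
    {M₁ M₂ M₃ : Type u}
    [TopologicalSpace M₁] [ChartedSpace H M₁] [IsManifold I ∞ M₁] [T2Space M₁] [CompactSpace M₁]
    [SecondCountableTopology M₁] [MeasurableSpace M₁] [BorelSpace M₁] [ConnectedSpace M₁]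
    [TopologicalSpace M₂] [ChartedSpace H M₂] [IsManifold I ∞ M₂] [T2Space M₂] [CompactSpace M₂]
    [SecondCountableTopology M₂] [MeasurableSpace M₂] [BorelSpace M₂] [ConnectedSpace M₂]
    [TopologicalSpace M₃] [ChartedSpace H M₃] [IsManifold I ∞ M₃] [T2Space M₃] [CompactSpace M₃]
    [SecondCountableTopology M₃] [MeasurableSpace M₃] [BorelSpace M₃] [ConnectedSpace M₃]
    {h₁ : ℝ → PseudoRiemannianMetric I ∞ (EuclideanSpace ℝ (Fin m)) (TangentSpace I : M₁ → Type _)}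
    {cov₁ : ℝ → CovariantDerivative I (EuclideanSpace ℝ (Fin m)) (TangentSpace I : M₁ → Type _)}
    {h₂ : ℝ → PseudoRiemannianMetric I ∞ (EuclideanSpace ℝ (Fin m)) (TangentSpace I : M₂ → Type _)}
    {cov₂ : ℝ → CovariantDerivative I (EuclideanSpace ℝ (Fin m)) (TangentSpace I : M₂ → Type _)}
    {h₃ : ℝ → PseudoRiemannianMetric I ∞ (EuclideanSpace ℝ (Fin m)) (TangentSpace I : M₃ → Type _)}
    {cov₃ : ℝ → CovariantDerivative I (EuclideanSpace ℝ (Fin m)) (TangentSpace I : M₃ → Type _)}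
    (hflow₁ : IsRicciFlow h₁ cov₁ (Icc a T)) (hh₁ : IsContMDiffFamilyOn ∞ h₁ univ)
    (hR₁ : ∀ r, (h₁ r).IsRiemannian)
    (hflow₂ : IsRicciFlow h₂ cov₂ (Icc a T)) (hh₂ : IsContMDiffFamilyOn ∞ h₂ univ)
    (hR₂ : ∀ r, (h₂ r).IsRiemannian)
    (hflow₃ : IsRicciFlow h₃ cov₃ (Icc a T)) (hh₃ : IsContMDiffFamilyOn ∞ h₃ univ)
    (hR₃ : ∀ r, (h₃ r).IsRiemannian) (haT : a < T) (x₁ : M₁) (x₂ : M₂) (x₃ : M₃) :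
    MetricFlowPair.fDist ∅ (ricciFlowMetricFlowPair hh₁ hR₁ hflow₁ haT x₁)
        (ricciFlowMetricFlowPair hh₃ hR₃ hflow₃ haT x₃) ≤
      MetricFlowPair.fDist ∅ (ricciFlowMetricFlowPair hh₁ hR₁ hflow₁ haT x₁)
          (ricciFlowMetricFlowPair hh₂ hR₂ hflow₂ haT x₂) +
        MetricFlowPair.fDist ∅ (ricciFlowMetricFlowPair hh₂ hR₂ hflow₂ haT x₂)
          (ricciFlowMetricFlowPair hh₃ hR₃ hflow₃ haT x₃) :=
  MetricFlowPair.HConc.fDist_empty_triangle (ricciFlowHConc hm hflow₁ hh₁ hR₁ haT x₁)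
    (ricciFlowHConc hm hflow₂ hh₂ hR₂ haT x₂) (ricciFlowHConc hm hflow₃ hh₃ hR₃ haT x₃)

end Literature.Geometry.Riemannian

end
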